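import Literature.MathematicalPhysics.QuantumFieldTheory.Balaban1983to89.B8Prop6CubeMemberBdryBeta
import Literature.MathematicalPhysics.QuantumFieldTheory.Balaban1983to89.B8Thm4KLevelGamma
import Literature.MathematicalPhysics.QuantumFieldTheory.Balaban1983to89.B8Ineq133CubeMemberGamma
import Literature.MathematicalPhysics.QuantumFieldTheory.Balaban1983to89.B8CubeMemberLamBPrimeLaws

/-!
# `Balaban1983to89.B8Prop6CubeMemberNormsGamma` — [Balaban1985RegularSpaces] PROPOSITION 3 (p. 87) ∕ PROPOSITION 6 (1.136) AT THE CONCRETE CUBE MEMBER,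
# BACKGROUND `1`, FROM THE FOUR-LINE COLLAR SOCKET OVER PRINT's SPLIT CLASS `cubeLamBP'` — EDITION γ (the «Aγ» norms engine of the cube road)

statement-level skeleton of published theorems with citation tags; proofs where landed; nothing here is a claim about the
Yang–Mills mass gap

PDF held: `paper:balaban1985-cmp99-regular-spaces-gauge-fixing` (journal page = PDF page + 74); pp. 77, 81–83, 86–87, 98–99; [4]
`paper:balaban1985-cmp99-background-propagators` (3.16) p. 393; [B6] `[Balaban1984PropagatorsII]` (2.3) p. 224.

CITATION HEADER (lean-in-tree rule).  Cell `pub-ymgap` (HUMAN RULING D-0062, Track A), DAG node N05 = [B8]; width seat `pub-ymgap-k0-s2-w1` (g0; K0⁷ stub 2 =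
[6] Prop. 6 at NODE 00's cube member), executing dag-n05-e g9's HAND-OUT «D2γ + Aγ» (bus 2026-08-27 23:16Z; dag-lead DEDUP-357 (1)).  WHY THIS FILE.  dag-n05-e's β
norms engine `B8Prop6CubeMemberBdryBeta.norms136_cubeMember_at_bdryβ_d4` (p544795) reads the four-line collar socket over dag-n05-c's class `cubeLamB`, whose condition 1
«box ⊂ □_j» EMPTIES print's crossing bonds of (1.31) at the levels `j ≥ 1`, so the interior shell gauge modes make that socket UNSATISFIABLE at every cube member with
`k ≥ 1` (certificate `B8Ineq159FlatShellModeVacuity` p572834) — the β engine is VACUOUS as typed.  EDITION γ (dag-lead DEDUP-349) reads the socket over dag-n05-e's split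
print class `cubeLamBP'` (dag-n06-b p579891; level `0`: inner bonds, the level-0 CROSSING bonds in the socket's own `CrossB` disjunct; levels `j ≥ 1`: dag-n05-c's
`cubeLamBP`, «at least one end in `□_j^{(j)}`»).  THIS FILE is the β engine RE-RUN in that edition; the ONE new step is the bound of the level-`j ≥ 1` crossing terms of
`|B₁|` by print's own route — (1.42) at the crossing bond (`B8Eq142KLevelLocalGamma.H42_of_inAx_γ`, the datum's (1.35) in print's p. 77 guard by dag-n05-c's
`B8Ineq133CubeMemberGamma.thm4_hypotheses_one_cutFixed_γ`) feeding (1.56) one level lower (`B8Thm4KLevelGamma.norm_B1_lt_kLevel_γ`, windows `(L²α₀′, Lα₂)`, constant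
`C₂ ≥ 2097152(d+1)²·L²`).  Kind «kernel-checked proof», theorems only, no `def`.

WHAT IS PROVED (kernel, 0 sorry).
§1 ★ `c137_cubeMember_γ` — (1.42)₂ AT ALL LEVELS for the gauge-fixed cut field `U₁ = U₀″^{u⁻¹}` at background `1`, on EVERY bond of the split print class
   `cubeLamBP' … k j`, `j ≤ k` (dag-n05-e g6's `B8Prop6CubeMemberNorms.c137_cubeMember` with `H42_of_inAx ↦ H42_of_inAx_γ`, the class laws from
   `B8CubeMemberLamBPrimeLaws`, the datum from `thm4_hypotheses_one_cutFixed_γ`, the windows at `(L²α₀′, Lα₂)`).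
§2 ★★ `norms136_cubeMember_at_γ_d4` — PROPOSITION 3's norm members of (1.136) at the cube member from the FOUR-LINE β-shaped socket `SockB9P3D4β … (cubeLamBP' …)`
   (by name) — dag-n05-e's `norms136_cubeMember_at_bdryβ_d4` VERBATIM except: the socket's class token `cubeLamB … k ↦ cubeLamBP' … k`, the `|B₁|` slot served by §1 +
   `norm_B1_lt_kLevel_γ` (box law «box ⊂ □_{j−1}», `cubeLamBP'_hbox_pred`), the smallness thresholds asked at `(L²α₀′, Lα₂)` (`L²·L³α₀ ≤ c`, `L·α₂ ≤ c`), and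
   `C₂ ≥ 2097152(d+1)²L²`.  SAME conclusions (`5dLB₀·(α₀′ + α₁′)` for the gradient ∕ `∂*∂` ∕ `Δ` members).

HONEST SCOPE ∕ A6.  (i) The four-line socket over `cubeLamBP'` at the member is a HYPOTHESIS — [4] Thm 3.3 for `G(1)`, `H(1)` on the finite cube family with exterior data,
averaging datum over print's class; dag-n06-b's `B9SupplySockB9P3ZdGamma.sockB9P3D4γ_allLevels_of_thm33_on` serves it from `B9.Thm33Printed` + six member-local binders,
A6-witnessed at truncation `m = 0` (`…nonvacuous_cubeLamBP'_zero`); levels `m ≥ 1` NOT witnessed (N06's object layer); the interior shell modes of p572834 do NOT inhabit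
this socket's datum (their crossing data are non-zero over print's class: dag-n05-c `B8Ineq159FlatShellModeCrossingDatum`, ref-E READ-12) — no satisfiability claim of mine
beyond that.  (ii) As every β-shaped socket: FALSE below an absolute threshold in `B₀` (boundary pure-gauge mode; the supplier's `B₀′ ≥ 1` absorbs it); the theorem holds for
every `B₀ > 0`.  (iii) `B_∂ ≥ 0`, `4B_∂ ≤ (dL − 1)B₀` as in β.  (iv) NODE 00's carrier `CubeB8` is wider than print's p. 98 cubes (dag-n05-e LOCATED-CARRIER): this engine
is per cube datum `(a, M, ρ, k)` with `L ≤ ρ ≤ M`, `11d < M`, all such.  Count-neutral; N05 ∕ K0⁷ stub 2 NOT discharged; one finite `𝕋⁴` programme at fixed `ε`, Bałaban AS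
PRINTED; nothing continuum ∕ ℝ⁴ ∕ OS ∕ mass-gap ∕ Clay (the Yang–Mills mass gap is NOT proved by any of this; route R4 closes the conditional finite-𝕋⁴ rung
`BalabanLadder.UV` only).  No `sorry`, no `def`, no `instance`, no `notation`.  Unit `pub-ymgap-k0-s2-w1` (g0), 2026-08-27.

RELATED IN THE TREE, NOT DUPLICATED (USED by name): `B8Prop6CubeMemberBdryBeta` (β engine; its imports ∕ mechanics: `regime_of_printed_smallness`, `norm_cutFixed_sub_one_le`,
`margin2_cubeFam`, `B8Prop3KLevelBdry.apriori_160_bdry ∕ apriori_162_bdry`, `B8Eq155KLevelLocal.eq155_norm_kLevel_hermitian`, `mlogCfg_spec`, `prop3_windows`),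
`B8Eq142KLevelLocalGamma.H42_of_inAx_γ` (p580875), `B8Thm4KLevelGamma.norm_B1_lt_kLevel_γ` (p581447), `B8Ineq133CubeMemberGamma.thm4_hypotheses_one_cutFixed_γ` (p584600),
`B9SupplySockB9P3ZdBeta.SockB9P3D4β` (class-parametric socket, by name), `B9SupplySockB9P3ZdGamma.cubeLamBP'`, `B8CubeMemberLamBPrimeLaws.{cubeLamBP'_hbox_pred, cubeLamBP'_hclass}`.
-/

noncomputable section

open NormedSpace

namespace Literature.MathematicalPhysics.QuantumFieldTheory.Balaban1983to89.B8Prop6CubeMemberNormsGamma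

open MatrixLog B7Prop1Explicit B7Prop2Explicit B7Prop1Local B7Eq92Concrete
open B7Prop2Explicit (C0 c2')
open B7Prop3Flat (c3)
open B7Prop4GeneralLevels (logCovIter linCovIter)
open B8Ineq132 (covDerivFwd InAk inAk_gaugeAct_iff BondTouches)
open B8Ineq133 (cutFixed)
open B8Lemma1NonAbelian (mulCfg)
open B8Eq115GaugeFixing (gaugeAct_mul gaugeAct_mem_of)
open B8Eq146AExpansion (iEta expCfg plaqCovDeriv)
open B8Eq143PlaqExpansion (pdiv)
open B8Eq184Proof (cfgExp)
open B8Eq140Level (SideTouches)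
open B8Eq119TwistedAxial (InAx Restr129 restr129_level_zero)
open B8Eq155JBound (Jcur wsup)
open B8ScaledSupNorm (bondNorm msup weight Bdd)
open B8Eq138LandauZd (IsLandau138W logCfg covLap)
open B8Eq131Cubes (tcube tLo tHi ctr)
open B8Ineq130 (gaugeAct_one)
open B8Eq131CubesAdmissible (cubeFam cubeFam_false_of_le)
open B8CubeMemberZd (cubeLamS cubeLamB hΩ_cubeFam cubeLamS_top mem_cubeLam_zero_iff)
open B9SupplySockB9P3ZdLettersOmega (margin2_cubeFam)
open B9SupplySockB9P3ZdBeta (CrossB SockB9P3D4β)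
open B9SupplySockB9P3ZdGamma (cubeLamBP')
open B8Prop6CubeMember (thm4_hypotheses_one_cutFixed regime_of_printed_smallness norm_cutFixed_sub_one_le)
open B8Ineq133CubeMemberGamma (thm4_hypotheses_one_cutFixed_γ)
open B8Prop6OfThm4 (const_136)
open B8Prop3GaugeFixedKLevel (inAk_congr_of_sideTouches expCfg_iEta_eq_cfgExp)
open B8LeafModelZd3 (mlogCfg mlogCfg_spec mlogCfg_of_sideTouches mlogCfg_of_not prop3_windows)
open B9Eq340HolderZd (hquot AdmPair)
open B8Eq142KLevelLocalGamma (H42_of_inAx_γ)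
open B8Thm4KLevelGamma (norm_B1_lt_kLevel_γ)
open B8CubeMemberLamBPrimeLaws (cubeLamBP'_hbox_pred cubeLamBP'_hclass)

-- `Site` alone could resolve to the torus sites of `Setup.lean`; re-export the `ℤ^d` sites of `B7Prop1Explicit`.
export B7Prop1Explicit (Site)

variable {d : ℕ}

variable {𝔸 : Type} [CStarAlgebra 𝔸] [Nontrivial 𝔸]

/-! ## §1 (1.42)₂ at all levels on print's split class, background `1` -/

/-- ★ **(1.42)₂ AT ALL LEVELS FOR `U₁ = U₀″^{u⁻¹}` AT BACKGROUND `1`, ON EVERY BOND OF THE SPLIT PRINT CLASS `cubeLamBP' … k j`** — dag-n05-e g6's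
`B8Prop6CubeMemberNorms.c137_cubeMember` re-run in edition γ: `H42_of_inAx_γ` at the Proposition-6 datum `(1, U₀″)` (unitarity, (1.33), (1.34) = (1.132), `Ax` at every
truncation, and (1.66) = (1.133) in PRINT's guard «box ⊂ □_{j−1}» by dag-n05-c's `thm4_hypotheses_one_cutFixed_γ`), class laws `cubeLamBP'_hbox_pred` ∕ `cubeLamBP'_hclass`
(`L ≤ ρ`), (1.29) w.r.t. `cubeLamS … k`, the exponent `A = mlogCfg` of the (1.62)-data; [3]-Prop.-4 windows ONE LEVEL LOWER, at `(L²·L³α₀, L·α₂)`.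
[cite: Balaban1985RegularSpaces, (1.42) p.83, (1.37) p.82, (1.31) p.82, (1.35) p.82, (1.133) p.99, p.77; Balaban1984PropagatorsII, (2.3) p.224] -/
theorem c137_cubeMember_γ (hd2 : 2 ≤ d) {L : ℕ} (hL : 2 ≤ L) {k : ℕ} (hk : 1 ≤ k)
    (U₀ : Site d → Fin d → 𝔸ˣ) (hU₀ : ∀ x κ, U₀ x κ ∈ unitaryUnits 𝔸) {α₀ : ℝ} (hα : 0 < α₀)
    (hα3 : C0 d * (α₀ * (L : ℝ) ^ 2) ≤ 1 / 3) (hα2 : 2 * (α₀ * (L : ℝ) ^ 2) ≤ c2' d L)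
    (a : Site d) {M ρ : ℕ} (hρL : L ≤ ρ) (hρM : ρ ≤ M) (hM : 11 * (d : ℝ) < M)
    {η : ℝ} (hη : 0 < η) {Ω : ℕ → Set (Site d)} (hA : InAk L k η α₀ Ω U₀) (hT : tcube L a M ρ k ⊆ Ω (k - 1))
    (hsmall : 11 * (d : ℝ) ^ 2 * (L : ℝ) ^ 2 * α₀ + ((M : ℝ) + 4 * ρ) * d * (L : ℝ) ^ 2 * α₀ ≤ 1 / 6)
    {α₂ : ℝ} (hα₂ : 0 ≤ α₂) (hα3' : C0 d * ((L : ℝ) ^ 2 * ((L : ℝ) ^ 3 * α₀)) ≤ 1 / 3) (hα4' : 4 * ((L : ℝ) ^ 2 * ((L : ℝ) ^ 3 * α₀)) ≤ c2' d L)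
    (h16 : 16 * α₂ ≤ 1) (h16' : 16 * ((L : ℝ) * α₂) ≤ 1)
    (hsm : Real.exp (4 * (800 * ((d : ℝ) + 1) ^ 2 * ((d : ℝ) + 4)) * ((L : ℝ) ^ 2 * ((L : ℝ) ^ 3 * α₀)))
      * (1 + 8 * (131072 * ((d : ℝ) + 1) ^ 2) * ((L : ℝ) * α₂)) ≤ 2)
    (hc₃ : 2 * ((L : ℝ) * α₂) ≤ c3 d L) (hsmall₁ : (d : ℝ) * L * (6 * d * (L : ℝ) ^ 2 * M * α₀) ≤ 1 / 8)
    (u : Site d → 𝔸ˣ) (hu : ∀ x, u x ∈ unitaryUnits 𝔸)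
    (h129 : Restr129 L k (cubeLamS L a M ρ k k) (1 : Site d → Fin d → 𝔸ˣ) u)
    (h162 : ∀ j, j ≤ k → ∀ b ∈ {b : Site d × Fin d | SideTouches (cubeFam false L a M ρ k j) b.1 b.2},
      gaugeAct u⁻¹ (cutFixed L (tLo a ρ) (tHi a M ρ) U₀ k (ctr a M)) b.1 b.2 =
          cfgExp η (logCfg η (gaugeAct u⁻¹ (cutFixed L (tLo a ρ) (tHi a M ρ) U₀ k (ctr a M)))) b.1 b.2 ∧
        IsSelfAdjoint (logCfg η (gaugeAct u⁻¹ (cutFixed L (tLo a ρ) (tHi a M ρ) U₀ k (ctr a M))) b.1 b.2) ∧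
        ‖logCfg η (gaugeAct u⁻¹ (cutFixed L (tLo a ρ) (tHi a M ρ) U₀ k (ctr a M))) b.1 b.2‖ ≤ α₂ * ((L : ℝ) ^ j * η)⁻¹) :
    ∀ j, j ≤ k → ∀ c ∈ cubeLamBP' L a M ρ k k j,
      ‖logCovIter L (1 : Site d → Fin d → 𝔸ˣ)
          (iEta η (mlogCfg k η (cubeFam false L a M ρ k) (gaugeAct u⁻¹ (cutFixed L (tLo a ρ) (tHi a M ρ) U₀ k (ctr a M)))))
          j c.1 c.2‖ < 2 * d * L * (6 * d * (L : ℝ) ^ 2 * M * α₀) := by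
  have hL1 : 1 ≤ L := le_trans (by norm_num) hL
  have hd1 : 1 ≤ d := le_trans (by norm_num) hd2
  have hρ : 1 ≤ ρ := hL1.trans hρL
  have hM1 : 1 ≤ M := hρ.trans hρM
  have hLpos : (0 : ℝ) < L := by exact_mod_cast hL1
  have hdpos : (0 : ℝ) < d := by exact_mod_cast hd1
  have hMpos : (0 : ℝ) < M := by exact_mod_cast hM1
  have hα₀' : 0 < (L : ℝ) ^ 3 * α₀ := by positivity
  have hα₁' : 0 < 6 * d * (L : ℝ) ^ 2 * M * α₀ := by positivity
  set U'' := cutFixed L (tLo a ρ) (tHi a M ρ) U₀ k (ctr a M) with hU''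
  obtain ⟨hmem, h33, h34, hAx, h135, -⟩ :=
    thm4_hypotheses_one_cutFixed_γ L hL hd1 k U₀ hU₀ hα hα3 hα2 a hρ hρM hM hη hA hT hsmall
  have hone : ∀ x κ, (1 : Site d → Fin d → 𝔸ˣ) x κ ∈ unitaryUnits 𝔸 := fun _ _ => (unitaryUnits 𝔸).one_mem
  have hU₁u : ∀ x κ, gaugeAct u⁻¹ U'' x κ ∈ unitaryUnits 𝔸 :=
    gaugeAct_mem_of hmem fun x => (unitaryUnits 𝔸).inv_mem (hu x)
  -- the canonical exponent: Hermitian, `= (1/iη) log U₁` on the `E j`, `U₁ = e^{iηA}` there, `0` off them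
  obtain ⟨hsa, hrep, hzero⟩ := mlogCfg_spec hη hL1 k (1 : Site d → Fin d → 𝔸ˣ) hU₁u hα₂ h16 (cubeFam false L a M ρ k)
    (fun j hj y τ hs => ⟨(h162 j hj (y, τ) hs).1, (h162 j hj (y, τ) hs).2.2⟩)
  have hWA : ∀ j, j ≤ k → ∀ y τ, SideTouches (cubeFam false L a M ρ k j) y τ →
      gaugeAct u⁻¹ U'' y τ = cfgExp η (mlogCfg k η (cubeFam false L a M ρ k) (gaugeAct u⁻¹ U'')) y τ ∧
        ‖mlogCfg k η (cubeFam false L a M ρ k) (gaugeAct u⁻¹ U'') y τ‖ ≤ α₂ * ((L : ℝ) ^ j * η)⁻¹ := fun j hj y τ hs =>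
    ⟨(hrep j hj y τ hs).2, by rw [(hrep j hj y τ hs).1]; exact (h162 j hj (y, τ) hs).2.2⟩
  -- `U₁^{u} = U₀″`
  have hgU : mgauge (1 : Site d → Fin d → 𝔸ˣ) u (gaugeAct u⁻¹ U'') = U'' := by
    rw [mgauge_one_left, ← gaugeAct_mul, mul_inv_cancel, gaugeAct_one]
  exact H42_of_inAx_γ hd2 hη hL k hone hα₀' hα₁' hα₂ hα3' hα4' h16' hsm hc₃ hsmall₁ (cubeFam false L a M ρ k)
    (hΩ_cubeFam hL1 a M hρL k) (cubeLamS L a M ρ k) (cubeLamBP' L a M ρ k) (cubeLamBP'_hbox_pred hL1 a M hρL k) (cubeLamBP'_hclass hL1 a M hρL k)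
    h33 h34 hAx h135 (fun _ _ => True) k hk le_rfl u (gaugeAct u⁻¹ U'') _ hu hgU h129 trivial hsa hWA hzero

#print axioms c137_cubeMember_γ

/-! ## §2 Proposition 3's norm members at the cube member from the FOUR-LINE socket over the split print class, EDITION γ -/

/-- ★★ **PROPOSITION 3 (p. 87) AT THE CONCRETE CUBE MEMBER, BACKGROUND `1`: THE NORM MEMBERS OF (1.136) FROM THE FOUR-LINE COLLAR SOCKET OVER PRINT's SPLIT CLASS
`cubeLamBP'`, EDITION γ** — dag-n05-e's `B8Prop6CubeMemberBdryBeta.norms136_cubeMember_at_bdryβ_d4` (four lines: `|A′|_(−1)`, `|∇A′|_(−2)`, `|∂*∂A′|_(−3)`, `|ΔA′|_(−3)`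
on the touching bonds, each `≤ B₀(|J|_(−3) + |B₁|) + B_∂·Φ₀(A′)`) with the averaging datum `|B₁|` = `sup` of `‖LʲηQ_j(iηA′)(c)‖` over `{(j, c) : c ∈ cubeLamBP' … k j}` ∪
`{(0, c) : c a CROSSING bond of □₀}` — the socket `SockB9P3D4β L B₀ B_∂ c_{B9} η k (cubeFam …) (cubeLamS …) (cubeLamBP' …)` BY NAME — and the collar `Φ₀` over the outer sides;
support clause «`u = 1` off `□₀`», `0 ≤ B_∂`, `4B_∂ ≤ (dL − 1)B₀`; SAME conclusions (`5dLB₀·s`, `s = α₀′ + α₁′`, for the three members).  The slot «|B₁| < 2dLα₁ + C₂α₂²»: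
on the class by (1.42)₂ at every level (§1) + (1.56) one level lower (`norm_B1_lt_kLevel_γ`, constant `8·131072(d+1)²·e^{…L²α₀′}·L²·α₂² ≤ C₂α₂²` for
`C₂ ≥ 2097152(d+1)²L²`); on a level-0 crossing term `η‖A′(b)‖ ≤ 2α₁′` (`u = 1` at both end-points).  Thresholds asked at `(L²α₀′, Lα₂)`.
[cite: Balaban1985RegularSpaces, Prop. 3 p.87, Prop. 6 (1.136) p.99, (1.29) p.81, (1.31) p.82, (1.42) p.83, (1.56)–(1.61) p.86, (1.133) p.99, p.77; Balaban1985BackgroundPropagators, (3.16) p.393; Balaban1984PropagatorsII, (2.3) p.224] -/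
theorem norms136_cubeMember_at_γ_d4 (hd2 : 2 ≤ d) {L : ℕ} (hL : 2 ≤ L) {B₀ C₂ cB9 Bbd : ℝ} (hB₀ : 0 < B₀)
    (hC₂ : 2097152 * ((d : ℝ) + 1) ^ 2 * (L : ℝ) ^ 2 ≤ C₂) (hcB9 : 0 < cB9) (hBbd : 0 ≤ Bbd) (hBd : 4 * Bbd ≤ ((d : ℝ) * L - 1) * B₀) :
    ∃ c : ℝ, 0 < c ∧ ∀ (η : ℝ), 0 < η → ∀ (k : ℕ), 1 ≤ k → ∀ (a : Site d) (M ρ : ℕ), L ≤ ρ → ρ ≤ M → 11 * (d : ℝ) < M →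
      -- the Prop.-3-frame b9 socket AT THE MEMBER over PRINT's split class, four lines (β shape), by name
      SockB9P3D4β (𝔸 := 𝔸) L B₀ Bbd cB9 η k (cubeFam false L a M ρ k) (cubeLamS L a M ρ k) (cubeLamBP' L a M ρ k) →
      ∀ (U₀ : Site d → Fin d → 𝔸ˣ), (∀ x κ, U₀ x κ ∈ unitaryUnits 𝔸) → ∀ (α₀ : ℝ), 0 < α₀ →
      C0 d * (α₀ * (L : ℝ) ^ 2) ≤ 1 / 3 → 2 * (α₀ * (L : ℝ) ^ 2) ≤ c2' d L →
      ∀ (Ω : ℕ → Set (Site d)), InAk L k η α₀ Ω U₀ → tcube L a M ρ k ⊆ Ω (k - 1) →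
      11 * (d : ℝ) ^ 2 * (L : ℝ) ^ 2 * α₀ + ((M : ℝ) + 4 * ρ) * d * (L : ℝ) ^ 2 * α₀ ≤ 1 / 6 →
      (L : ℝ) ^ 2 * ((L : ℝ) ^ 3 * α₀) ≤ c → (L : ℝ) * (5 * (d : ℝ) * L * B₀ * ((L : ℝ) ^ 3 * α₀ + 6 * d * (L : ℝ) ^ 2 * M * α₀)) ≤ c →
      2 * (5 * (d : ℝ) * L * B₀ * ((L : ℝ) ^ 3 * α₀ + 6 * d * (L : ℝ) ^ 2 * M * α₀)) ^ 2
        + 20 * d * ((L : ℝ) ^ 3 * α₀) * (5 * (d : ℝ) * L * B₀ * ((L : ℝ) ^ 3 * α₀ + 6 * d * (L : ℝ) ^ 2 * M * α₀))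
        + 2 * C₂ * (5 * (d : ℝ) * L * B₀ * ((L : ℝ) ^ 3 * α₀ + 6 * d * (L : ℝ) ^ 2 * M * α₀)) ^ 2
        ≤ (L : ℝ) ^ 3 * α₀ + 6 * d * (L : ℝ) ^ 2 * M * α₀ →
      (d : ℝ) * L * (6 * d * (L : ℝ) ^ 2 * M * α₀) ≤ 1 / 8 →
      ∀ (u : Site d → 𝔸ˣ), (∀ x, u x ∈ unitaryUnits 𝔸) → (∀ x, x ∉ cubeFam false L a M ρ k 0 → u x = 1) →
      Restr129 L k (cubeLamS L a M ρ k k) (1 : Site d → Fin d → 𝔸ˣ) u →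
      IsLandau138W L k η (cubeFam false L a M ρ k 0) (cubeLamS L a M ρ k k) (1 : Site d → Fin d → 𝔸ˣ)
        (gaugeAct u⁻¹ (cutFixed L (tLo a ρ) (tHi a M ρ) U₀ k (ctr a M))) →
      (∀ j, j ≤ k → ∀ b ∈ {b : Site d × Fin d | SideTouches (cubeFam false L a M ρ k j) b.1 b.2},
        gaugeAct u⁻¹ (cutFixed L (tLo a ρ) (tHi a M ρ) U₀ k (ctr a M)) b.1 b.2 =
            cfgExp η (logCfg η (gaugeAct u⁻¹ (cutFixed L (tLo a ρ) (tHi a M ρ) U₀ k (ctr a M)))) b.1 b.2 ∧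
          IsSelfAdjoint (logCfg η (gaugeAct u⁻¹ (cutFixed L (tLo a ρ) (tHi a M ρ) U₀ k (ctr a M))) b.1 b.2) ∧
          ‖logCfg η (gaugeAct u⁻¹ (cutFixed L (tLo a ρ) (tHi a M ρ) U₀ k (ctr a M))) b.1 b.2‖ ≤
            (5 * (d : ℝ) * L * B₀ * ((L : ℝ) ^ 3 * α₀ + 6 * d * (L : ℝ) ^ 2 * M * α₀)) * ((L : ℝ) ^ j * η)⁻¹) →
      msup L k η (-(2 : ℝ)) (fun j (t : Fin d × Fin d × Site d) => SideTouches (cubeFam false L a M ρ k j) t.2.2 t.2.1)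
          (fun t => covDerivFwd η (1 : Site d → Fin d → 𝔸ˣ) t.1 (fun z => mlogCfg k η (cubeFam false L a M ρ k)
            (gaugeAct u⁻¹ (cutFixed L (tLo a ρ) (tHi a M ρ) U₀ k (ctr a M))) z t.2.1) t.2.2)
        ≤ 5 * (d : ℝ) * L * B₀ * ((L : ℝ) ^ 3 * α₀ + 6 * d * (L : ℝ) ^ 2 * M * α₀) ∧
      bondNorm L k η (-(3 : ℝ)) (cubeFam false L a M ρ k) (fun x μ => pdiv η (1 : Site d → Fin d → 𝔸ˣ)
          (plaqCovDeriv η (1 : Site d → Fin d → 𝔸ˣ) (mlogCfg k η (cubeFam false L a M ρ k)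
            (gaugeAct u⁻¹ (cutFixed L (tLo a ρ) (tHi a M ρ) U₀ k (ctr a M))))) μ x)
        ≤ 5 * (d : ℝ) * L * B₀ * ((L : ℝ) ^ 3 * α₀ + 6 * d * (L : ℝ) ^ 2 * M * α₀) ∧
      bondNorm L k η (-(3 : ℝ)) (cubeFam false L a M ρ k) (fun x μ => covLap η (1 : Site d → Fin d → 𝔸ˣ)
          (fun z => mlogCfg k η (cubeFam false L a M ρ k) (gaugeAct u⁻¹ (cutFixed L (tLo a ρ) (tHi a M ρ) U₀ k (ctr a M))) z μ) x)
        ≤ 5 * (d : ℝ) * L * B₀ * ((L : ℝ) ^ 3 * α₀ + 6 * d * (L : ℝ) ^ 2 * M * α₀) := by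
  have hL1 : 1 ≤ L := le_trans (by norm_num) hL
  have hd1 : 1 ≤ d := le_trans (by norm_num) hd2
  obtain ⟨cw, hcw, hwin⟩ := prop3_windows hd2 hL hB₀.le
  refine ⟨min cB9 cw, lt_min hcB9 hcw, ?_⟩
  intro η hη k hk a M ρ hρL hρM hM SB9D U₀ hU₀ α₀ hα hα3 hα2 Ω hA hT hsmall hc₀ hc₂ h61 hsmall₁ u hu huS h129 hLan h162
  have hρ : 1 ≤ ρ := hL1.trans hρL
  have hM1 : 1 ≤ M := hρ.trans hρM
  have hLr : (1 : ℝ) ≤ L := by exact_mod_cast hL1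
  have hdpos : (0 : ℝ) < d := by exact_mod_cast hd1
  have hMpos : (0 : ℝ) < M := by exact_mod_cast hM1
  set α₀' : ℝ := (L : ℝ) ^ 3 * α₀ with hα₀'_def
  set α₁' : ℝ := 6 * d * (L : ℝ) ^ 2 * M * α₀ with hα₁'_def
  set α₂ : ℝ := 5 * (d : ℝ) * L * B₀ * ((L : ℝ) ^ 3 * α₀ + 6 * d * (L : ℝ) ^ 2 * M * α₀) with hα₂_def
  have hα₀' : 0 < α₀' := by positivity
  have hα₁' : 0 < α₁' := by positivity
  have hα₂ : 0 < α₂ := by positivity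
  -- the thresholds at `(α₀′, α₂)` follow from those at `(L²α₀′, Lα₂)` (`L ≥ 1`)
  have hL2 : (1 : ℝ) ≤ (L : ℝ) ^ 2 := one_le_pow₀ hLr
  have hc₀' : α₀' ≤ min cB9 cw := (le_mul_of_one_le_left hα₀'.le hL2).trans hc₀
  have hc₂' : α₂ ≤ min cB9 cw := (le_mul_of_one_le_left hα₂.le hLr).trans hc₂
  have hLα₀' : 0 < (L : ℝ) ^ 2 * α₀' := by positivity
  have hLα₂ : 0 ≤ (L : ℝ) * α₂ := by positivity
  obtain ⟨hα3', hα4', h16, hd5, hsm, hc₃, hside, h50, hC⟩ :=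
    hwin α₀' α₂ hα₀' (hc₀'.trans (min_le_right _ _)) hα₂.le (hc₂'.trans (min_le_right _ _))
  obtain ⟨hα3γ, hα4γ, h16γ, -, hsmγ, hc₃γ, -, -, hCγ⟩ :=
    hwin ((L : ℝ) ^ 2 * α₀') ((L : ℝ) * α₂) hLα₀' (hc₀.trans (min_le_right _ _)) hLα₂ (hc₂.trans (min_le_right _ _))
  set U'' := cutFixed L (tLo a ρ) (tHi a M ρ) U₀ k (ctr a M) with hU''
  obtain ⟨hmem, h33, h34, -, -, -⟩ := thm4_hypotheses_one_cutFixed L hL hd1 k U₀ hU₀ hα hα3 hα2 a hρ hρM hM hη hA hT hsmall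
  have hone : ∀ x κ, (1 : Site d → Fin d → 𝔸ˣ) x κ ∈ unitaryUnits 𝔸 := fun _ _ => (unitaryUnits 𝔸).one_mem
  have hui : ∀ x, u⁻¹ x ∈ U1 𝔸 := fun x => unitaryUnits_le_U1 ((unitaryUnits 𝔸).inv_mem (hu x))
  have hU₁u : ∀ x κ, gaugeAct u⁻¹ U'' x κ ∈ unitaryUnits 𝔸 := gaugeAct_mem_of hmem fun x => (unitaryUnits 𝔸).inv_mem (hu x)
  set W : Site d → Fin d → 𝔸ˣ := gaugeAct u⁻¹ U'' with hW_def
  set A : Site d → Fin d → 𝔸 := mlogCfg k η (cubeFam false L a M ρ k) W with hA_def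
  -- the canonical exponent: Hermitian, (1.41), `W = e^{iηA}` on the `E j`, `0` off them
  obtain ⟨hAsa, hrep, hA0⟩ := mlogCfg_spec hη hL1 k (1 : Site d → Fin d → 𝔸ˣ) hU₁u hα₂.le h16 (cubeFam false L a M ρ k)
    (fun j hj y τ hs => ⟨(h162 j hj (y, τ) hs).1, (h162 j hj (y, τ) hs).2.2⟩)
  have h41 : ∀ j, j ≤ k → ∀ (y : Site d) (τ : Fin d), SideTouches (cubeFam false L a M ρ k j) y τ →
      W y τ = cfgExp η A y τ ∧ ‖A y τ‖ ≤ α₂ * ((L : ℝ) ^ j * η)⁻¹ := fun j hj y τ hs =>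
    ⟨(hrep j hj y τ hs).2, by rw [hA_def, (hrep j hj y τ hs).1]; exact (h162 j hj (y, τ) hs).2.2⟩
  have h41' : ∀ j, j ≤ k → ∀ (y : Site d) (τ : Fin d), SideTouches (cubeFam false L a M ρ k j) y τ →
      ‖A y τ‖ ≤ α₂ * ((L : ℝ) ^ j * η)⁻¹ := fun j hj y τ hs => (h41 j hj y τ hs).2
  -- (1.40)₂ for `W·1` by gauge invariance from (1.132), and for `e^{iηA}·1` by locality
  have hW₀ : mulCfg U'' (1 : Site d → Fin d → 𝔸ˣ) = U'' := mul_one _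
  have hW₁ : mulCfg W (1 : Site d → Fin d → 𝔸ˣ) = W := mul_one _
  have hPair : InAk L k η α₀' (cubeFam false L a M ρ k) (mulCfg W (1 : Site d → Fin d → 𝔸ˣ)) := by
    rw [hW₁, hW_def, inAk_gaugeAct_iff L k η _ _ hui]
    rw [hW₀] at h34
    exact h34
  have h40₁ : InAk L k η α₀' (cubeFam false L a M ρ k) (mulCfg (expCfg (iEta η A)) (1 : Site d → Fin d → 𝔸ˣ)) := by
    refine (inAk_congr_of_sideTouches L k η α₀' (V := mulCfg W (1 : Site d → Fin d → 𝔸ˣ)) fun j hj y τ hs => ?_).1 hPair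
    show W y τ * (1 : Site d → Fin d → 𝔸ˣ) y τ = expCfg (iEta η A) y τ * (1 : Site d → Fin d → 𝔸ˣ) y τ
    rw [(h41 j hj y τ hs).1, expCfg_iEta_eq_cfgExp]
  have hAglob : ∀ y τ, ‖A y τ‖ ≤ α₂ * η⁻¹ := by
    intro y τ
    by_cases hmem' : ∃ j, j ≤ k ∧ SideTouches (cubeFam false L a M ρ k j) y τ
    · obtain ⟨j, hj, hs⟩ := hmem'
      have hLj : (1 : ℝ) ≤ (L : ℝ) ^ j := one_le_pow₀ hLr
      calc ‖A y τ‖ ≤ α₂ * ((L : ℝ) ^ j * η)⁻¹ := h41' j hj y τ hs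
        _ = α₂ * η⁻¹ * ((L : ℝ) ^ j)⁻¹ := by rw [mul_inv]; ring
        _ ≤ α₂ * η⁻¹ * 1 := by
            apply mul_le_mul_of_nonneg_left (inv_le_one_of_one_le₀ hLj) (by positivity)
        _ = α₂ * η⁻¹ := mul_one _
    · rw [hA_def, hA0 y τ fun j hj hs => hmem' ⟨j, hj, hs⟩, norm_zero]
      positivity
  have hgrad : ∀ (y : Site d) (κ τ : Fin d), ‖covDerivFwd η (1 : Site d → Fin d → 𝔸ˣ) κ (fun z => A z τ) y‖ ≤ 2 * α₂ * η⁻¹ * η⁻¹ := by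
    intro y κ τ
    unfold covDerivFwd
    rw [norm_smul, norm_inv, Real.norm_eq_abs, abs_of_pos hη]
    have h1 : ‖B7Eq78Linearization.conjR ((1 : Site d → Fin d → 𝔸ˣ) y κ) (A (y + e κ) τ) - A y τ‖ ≤ α₂ * η⁻¹ + α₂ * η⁻¹ := by
      calc ‖B7Eq78Linearization.conjR ((1 : Site d → Fin d → 𝔸ˣ) y κ) (A (y + e κ) τ) - A y τ‖
          ≤ ‖B7Eq78Linearization.conjR ((1 : Site d → Fin d → 𝔸ˣ) y κ) (A (y + e κ) τ)‖ + ‖A y τ‖ := norm_sub_le _ _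
        _ ≤ α₂ * η⁻¹ + α₂ * η⁻¹ := by
            rw [B8Ineq132.norm_conjR (unitaryUnits_le_U1 (hone y κ))]
            exact add_le_add (hAglob _ _) (hAglob _ _)
    calc η⁻¹ * ‖B7Eq78Linearization.conjR ((1 : Site d → Fin d → 𝔸ˣ) y κ) (A (y + e κ) τ) - A y τ‖ ≤ η⁻¹ * (α₂ * η⁻¹ + α₂ * η⁻¹) :=
        mul_le_mul_of_nonneg_left h1 (by positivity)
      _ = 2 * α₂ * η⁻¹ * η⁻¹ := by ring
  have hBg : Bdd L k η (-(2 : ℝ)) (fun j (t : Fin d × Fin d × Site d) => SideTouches (cubeFam false L a M ρ k j) t.2.2 t.2.1)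
      (fun t => covDerivFwd η (1 : Site d → Fin d → 𝔸ˣ) t.1 (fun z => A z t.2.1) t.2.2) := by
    have e2 : (-(2 : ℝ)) = -((2 : ℕ) : ℝ) := by norm_num
    rw [e2]
    refine B8ScaledSupNorm.bdd_of_forall (c := 2 * α₂ * ((L : ℝ) ^ k) ^ 2) fun j hj t _ => ?_
    rw [B8ScaledSupNorm.weight_neg_natCast L η 2 j]
    have hLjk : (L : ℝ) ^ j ≤ (L : ℝ) ^ k := pow_le_pow_right₀ hLr hj
    have hLj0 : (0 : ℝ) ≤ (L : ℝ) ^ j := by positivity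
    calc ((L : ℝ) ^ j * η) ^ 2 * ‖covDerivFwd η (1 : Site d → Fin d → 𝔸ˣ) t.1 (fun z => A z t.2.1) t.2.2‖
        ≤ ((L : ℝ) ^ j * η) ^ 2 * (2 * α₂ * η⁻¹ * η⁻¹) := mul_le_mul_of_nonneg_left (hgrad _ _ _) (by positivity)
      _ = 2 * α₂ * ((L : ℝ) ^ j) ^ 2 := by field_simp
      _ ≤ 2 * α₂ * ((L : ℝ) ^ k) ^ 2 := by gcongr
  set g : ℝ := msup L k η (-(2 : ℝ)) (fun j (t : Fin d × Fin d × Site d) => SideTouches (cubeFam false L a M ρ k j) t.2.2 t.2.1)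
      (fun t => covDerivFwd η (1 : Site d → Fin d → 𝔸ˣ) t.1 (fun z => A z t.2.1) t.2.2) with hg_def
  have hg0 : 0 ≤ g := B8ScaledSupNorm.msup_nonneg L k hη.le _ _ _
  have hg : ∀ j, j ≤ k → ∀ (y : Site d) (κ τ : Fin d), SideTouches (cubeFam false L a M ρ k j) y τ →
      ((L : ℝ) ^ j * η) ^ 2 * ‖covDerivFwd η (1 : Site d → Fin d → 𝔸ˣ) κ (fun z => A z τ) y‖ ≤ g := by
    intro j hj y κ τ hs
    have h := B8ScaledSupNorm.weight_mul_norm_le_msup hBg hj (i := (κ, τ, y)) hs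
    have hw : weight L η (-(2 : ℝ)) j = ((L : ℝ) ^ j * η) ^ 2 := by
      have e2 : (-(2 : ℝ)) = -((2 : ℕ) : ℝ) := by norm_num
      rw [e2, B8ScaledSupNorm.weight_neg_natCast L η 2 j]
    rw [hw] at h
    exact h
  -- the in-edge (1.59), four lines, from the socket AT THE MEMBER over print's split class (by name)
  obtain ⟨h59a, h59g, h59j, h59l⟩ := SB9D α₀' α₂ hα₀' (hc₀'.trans (min_le_left _ _)) hα₂ (hc₂'.trans (min_le_left _ _))
    (1 : Site d → Fin d → 𝔸ˣ) W hone hU₁u h33 hPair hLan A hAsa h41 hA0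
  -- (1.42)₂ at all levels on the split class (§1) and its γ box law
  have h42 := c137_cubeMember_γ hd2 hL hk U₀ hU₀ hα hα3 hα2 a hρL hρM hM hη hA hT hsmall hα₂.le hα3γ hα4γ h16 h16γ hsmγ hc₃γ hsmall₁ u hu
    h129 h162
  have hbox : ∀ j, j ≤ k → ∀ c ∈ cubeLamBP' L a M ρ k k j, ∀ x, InBox (loK L j c.1) (bondHiK L j c.1 c.2) x → x ∈ cubeFam false L a M ρ k (j - 1) :=
    fun j hj c hc x hx => cubeLamBP'_hbox_pred hL1 a M hρL k k le_rfl j hj c hc x hx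
  -- `u = 1` AT EVERY SITE OF `□₀` WITH A NEIGHBOUR (sup-distance ≤ 2) OUTSIDE `□₀`: such a site is not in `□₁` (margin of (1.131)), hence lies in
  -- `Λ₀ = □₀ ∖ □₁`, where (1.29) at level 0 pins `u = 1`
  have hM2 := margin2_cubeFam L a M (hL.trans hρL) k
  have hlayer : ∀ y z : Site d, y ∈ cubeFam false L a M ρ k 0 → z ∉ cubeFam false L a M ρ k 0 →
      (∀ i, y i - 2 ≤ z i ∧ z i ≤ y i + 2) → u y = 1 := by
    intro y z hy hz hyz
    have hy1 : y ∉ cubeFam false L a M ρ k 1 := fun h1 => hz (hM2 1 le_rfl y h1 z hyz)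
    have hy0 : y ∈ B8CubeMemberZd.cubeLam L a M ρ k 0 := by
      rw [mem_cubeLam_zero_iff hL1 a M ρ hk, ← cubeFam_false_of_le L a M ρ (Nat.zero_le k), ← cubeFam_false_of_le L a M ρ hk]
      exact ⟨hy, hy1⟩
    have hyS : y ∈ cubeLamS L a M ρ k k 0 := by rw [cubeLamS_top L a M ρ (Nat.zero_le k)]; exact hy0
    exact Units.val_eq_one.mp (restr129_level_zero h129 hyS)
  -- ON A TOUCHING SIDE OF `□₀` NOT HAVING BOTH END-POINTS IN `□₀` (an outer side, or a CROSSING bond): `u = 1` at both end-points, so `W = U₀″`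
  -- there and `η‖A‖ = ‖log U₀″‖ ≤ 2‖U₀″ − 1‖ ≤ 2·6dL²Mα₀` by (1.133)₀ read on every bond (`norm_cutFixed_sub_one_le`)
  have hcol : ∀ b : Site d × Fin d, SideTouches (cubeFam false L a M ρ k 0) b.1 b.2 →
      ¬ (b.1 ∈ cubeFam false L a M ρ k 0 ∧ b.1 + e b.2 ∈ cubeFam false L a M ρ k 0) → η * ‖A b.1 b.2‖ ≤ 2 * α₁' := by
    intro b hsd hnb
    have he1 : ∀ i, b.1 i - 2 ≤ (b.1 + e b.2) i ∧ (b.1 + e b.2) i ≤ b.1 i + 2 := by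
      intro i
      simp only [Pi.add_apply, e_apply]
      split_ifs <;> constructor <;> omega
    have he2 : ∀ i, (b.1 + e b.2) i - 2 ≤ b.1 i ∧ b.1 i ≤ (b.1 + e b.2) i + 2 := by
      intro i
      simp only [Pi.add_apply, e_apply]
      split_ifs <;> constructor <;> omega
    have hx : u b.1 = 1 := by
      by_cases h : b.1 ∈ cubeFam false L a M ρ k 0
      · exact hlayer b.1 (b.1 + e b.2) h (fun h' => hnb ⟨h, h'⟩) he1
      · exact huS _ h
    have hxe : u (b.1 + e b.2) = 1 := by
      by_cases h : b.1 + e b.2 ∈ cubeFam false L a M ρ k 0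
      · exact hlayer (b.1 + e b.2) b.1 h (fun h' => hnb ⟨h', h⟩) he2
      · exact huS _ h
    have hWb : W b.1 b.2 = U'' b.1 b.2 := by
      show gaugeAct u⁻¹ U'' b.1 b.2 = U'' b.1 b.2
      simp only [gaugeAct, Pi.inv_apply, hx, hxe, inv_one, one_mul, mul_one]
    have hAb : A b.1 b.2 = logCfg η W b.1 b.2 := mlogCfg_of_sideTouches η W (Nat.zero_le k) hsd
    have hUb : ‖((U'' b.1 b.2 : 𝔸ˣ) : 𝔸) - 1‖ ≤ α₁' :=
      norm_cutFixed_sub_one_le L hL hd1 (avgClosed_unitaryUnits (𝔸 := 𝔸) d L) k U₀ hU₀ hα hα3 hα2 a hρ hρM hM hA hT hsmall b.1 b.2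
    have hU1 : ‖((U'' b.1 b.2 : 𝔸ˣ) : 𝔸) - 1‖ ≤ 1 / 2 := hUb.trans (by
      have hdL1 : (1 : ℝ) ≤ (d : ℝ) * L := one_le_mul_of_one_le_of_one_le (by exact_mod_cast hd1) hLr
      have h1 : α₁' ≤ (d : ℝ) * L * α₁' := le_mul_of_one_le_left hα₁'.le hdL1
      linarith [hsmall₁])
    rw [hAb, logCfg, hWb, norm_smul, norm_smul, norm_inv, norm_inv, Complex.norm_I, inv_one, one_mul, Real.norm_eq_abs,
      abs_of_pos hη, ← mul_assoc, mul_inv_cancel₀ hη.ne', one_mul]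
    exact (MatrixLog.norm_mlog_le_two_mul hU1).trans (by linarith [hUb])
  -- THE COLLAR TERM `Φ₀(A′)` (outer sides: both end-points outside `□₀`) `≤ 2α₁′`
  set Φ₀ : ℝ := msup L k η (-(1 : ℝ))
      (fun j (b : Site d × Fin d) => j = 0 ∧ SideTouches ((cubeFam false L a M ρ k) 0) b.1 b.2 ∧ ¬ BondTouches ((cubeFam false L a M ρ k) 0) b.1 b.2)
      (fun b => A b.1 b.2) with hΦ₀_def
  have hΦ₀ : Φ₀ ≤ 2 * α₁' := by
    refine B8ScaledSupNorm.msup_le (by positivity) fun j hj b hb => ?_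
    obtain ⟨rfl, hsd, hnb⟩ := hb
    have e1 : (-(1 : ℝ)) = -((1 : ℕ) : ℝ) := by norm_num
    rw [e1, B8ScaledSupNorm.weight_neg_natCast L η 1 0, pow_one, pow_zero, one_mul]
    exact hcol b hsd fun h => hnb (Or.inl h.1)
  have hΦ₀0 : 0 ≤ Φ₀ := B8ScaledSupNorm.msup_nonneg L k hη.le _ _ _
  -- the window: `2·Bbd·Φ₀ ≤ 4·Bbd·α₁′ ≤ (dL − 1)B₀(α₀′ + α₁′)`
  have hβ : Bbd * Φ₀ + Bbd * Φ₀ ≤ ((d : ℝ) * L - 1) * B₀ * (α₀' + α₁') := by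
    have h1 : Bbd * Φ₀ + Bbd * Φ₀ ≤ 4 * Bbd * α₁' := by
      have h := mul_le_mul_of_nonneg_left hΦ₀ hBbd
      linarith
    have h2 : 4 * Bbd * α₁' ≤ ((d : ℝ) * L - 1) * B₀ * α₁' := mul_le_mul_of_nonneg_right hBd hα₁'.le
    have h3 : 0 ≤ ((d : ℝ) * L - 1) * B₀ := le_trans (by positivity) hBd
    have h4 : ((d : ℝ) * L - 1) * B₀ * α₁' ≤ ((d : ℝ) * L - 1) * B₀ * (α₀' + α₁') :=
      mul_le_mul_of_nonneg_left (le_add_of_nonneg_left hα₀'.le) h3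
    linarith
  -- PROPOSITION 3 at `k` levels with the allowances (dag-n05-e's `B8Prop3KLevelBdry`), then the slack absorbs them
  have h₀ : ∀ y κ, (1 : Site d → Fin d → 𝔸ˣ) y κ ∈ U1 𝔸 := fun y κ => unitaryUnits_le_U1 (hone y κ)
  have h55 := B8Eq155KLevelLocal.eq155_norm_kLevel_hermitian hη hL1 h₀ hAsa hα₀'.le hα₂.le h16 hd5 hg0 h33 h40₁ h41' hg
  have h41'' : ∀ j, j ≤ k → ∀ x μ, BondTouches (cubeFam false L a M ρ k j) x μ → ‖A x μ‖ ≤ α₂ * ((L : ℝ) ^ j * η)⁻¹ :=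
    fun j hj x μ hb => B8Prop3KLevel.bound_of_sideTouches hd2 (h41' j hj) x μ hb
  -- «|B₁| < 2dLα₁ + C₂α₂²»: on the split print class by (1.42)₂ (§1) + (1.56) ONE LEVEL LOWER (`norm_B1_lt_kLevel_γ`, box law «box ⊂ □_{j−1}»);
  -- on a level-0 CROSSING bond `Q₀ = 1`, the term is `η‖A′(b)‖ ≤ 2α₁′ ≤ 2dLα₁′` (`hcol`) — print's «B on Λ₀»
  have hdL : (1 : ℝ) ≤ (d : ℝ) * L := one_le_mul_of_one_le_of_one_le (by exact_mod_cast hd1) hLr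
  set Cγ : ℝ := 8 * (131072 * ((d : ℝ) + 1) ^ 2) * Real.exp (4 * (800 * ((d : ℝ) + 1) ^ 2 * ((d : ℝ) + 4)) * ((L : ℝ) ^ 2 * α₀')) * (L : ℝ) ^ 2
    with hCγ_def
  have hC0 : 0 ≤ Cγ * α₂ ^ 2 := by positivity
  haveI : Nontrivial (Fin d) := Fin.nontrivial_iff_two_le.mpr hd2
  obtain ⟨-, hg', hj', hl'⟩ := B8Prop3KLevelBdry.apriori_160_bdry (L := (L : ℝ)) (B₀ := B₀) (α₁ := α₁') (C₂ := Cγ)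
    (Nat.cast_nonneg d) hB₀.le hα₂.le hg0 h55
    (by
      refine B8Eq155JBound.wsup_le (fun p => ?_) (by positivity)
      obtain ⟨⟨j, b⟩, hj, hc | ⟨hj0, hcr⟩⟩ := p
      · have hj' : j ≤ k := hj
        have hc' : b ∈ cubeLamBP' L a M ρ k k j := hc
        show 1 * ‖linCovIter L (1 : Site d → Fin d → 𝔸ˣ) (iEta η A) j b.1 b.2‖ ≤ _
        rw [one_mul]
        have h := norm_B1_lt_kLevel_γ hη L hL (avgClosed_unitaryUnits d L) (1 : Site d → Fin d → 𝔸ˣ) hone hα₀' hα3γ hα4γ A hα₂.le hsmγ hc₃γ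
          hbox h33 h41'' h42 hj' hc'
        have e : 8 * (131072 * ((d : ℝ) + 1) ^ 2)
            * Real.exp (4 * (800 * ((d : ℝ) + 1) ^ 2 * ((d : ℝ) + 4)) * ((L : ℝ) ^ 2 * α₀')) * (L : ℝ) ^ 2 * α₂ ^ 2 = Cγ * α₂ ^ 2 := by
          rw [hCγ_def]
        linarith [h, e]
      · have hj0' : j = 0 := hj0
        subst hj0'
        have hbt' : BondTouches (cubeFam false L a M ρ k 0) b.1 b.2 := hcr.1
        have hnb' : ¬ (b.1 ∈ cubeFam false L a M ρ k 0 ∧ b.1 + e b.2 ∈ cubeFam false L a M ρ k 0) := hcr.2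
        show 1 * ‖linCovIter L (1 : Site d → Fin d → 𝔸ˣ) (iEta η A) 0 b.1 b.2‖ ≤ _
        rw [one_mul, B7Prop4GeneralLevels.linCovIter_zero, B8Eq154Local.norm_iEta_apply hη.le]
        obtain ⟨κ, hκ⟩ := exists_ne b.2
        have hsd : SideTouches (cubeFam false L a M ρ k 0) b.1 b.2 := B8Eq140Level.sideTouches_of_bondTouches hκ hbt'
        have h1 : 2 * α₁' ≤ 2 * d * L * α₁' := by
          have h := mul_le_mul_of_nonneg_right hdL (by positivity : (0 : ℝ) ≤ 2 * α₁')
          linarith [h]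
        linarith [hcol b hsd hnb', h1, hC0])
    h59a h59g h59j h59l hside h50
  have hK : 2 * Cγ * α₂ ^ 2 ≤ 2 * C₂ * α₂ ^ 2 := by
    have hL20 : (0 : ℝ) ≤ (L : ℝ) ^ 2 := by positivity
    have hCγ' : Cγ ≤ 2097152 * ((d : ℝ) + 1) ^ 2 * (L : ℝ) ^ 2 := by
      rw [hCγ_def]
      exact mul_le_mul_of_nonneg_right hCγ hL20
    have h := mul_le_mul_of_nonneg_right (hCγ'.trans hC₂) (sq_nonneg α₂)
    linarith
  have hR : B₀ * (4 * α₀' + 4 * d * L * α₁' + 2 * α₂ ^ 2 + 20 * d * α₀' * α₂ + 2 * Cγ * α₂ ^ 2)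
      ≤ B₀ * (4 * α₀' + 4 * d * L * α₁' + 2 * α₂ ^ 2 + 20 * d * α₀' * α₂ + 2 * C₂ * α₂ ^ 2) :=
    mul_le_mul_of_nonneg_left (by linarith [hK]) hB₀.le
  have h162 := B8Prop3KLevelBdry.apriori_162_bdry (C₂ := C₂) (α₂ := α₂) hB₀.le hdL hα₀'.le h61 hβ
  have e5 : 5 * (d : ℝ) * L * B₀ * (α₀' + α₁') = α₂ := by simp only [hα₀'_def, hα₁'_def, hα₂_def]
  refine ⟨?_, ?_, ?_⟩
  · linarith [hg', hR, h162, e5]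
  · linarith [hj', hR, h162, e5]
  · linarith [hl', hR, h162, e5]

#print axioms norms136_cubeMember_at_γ_d4

end Literature.MathematicalPhysics.QuantumFieldTheory.Balaban1983to89.B8Prop6CubeMemberNormsGamma

end
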